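import Mathlib
import HarnessLib

/-!
# Signed intercalate matrices and the Hrubeš–Wigderson–Yehudayoff colour bound `k⁶ ≤ 250·n⁵`

Workshop file for the node `CommutativityDial` (decomposition workshop `decomp-valiant`, lens 6
«restricted-models lifting axis», gen 34; census cell D2 / W15; CALL O-L6-10 (bus 1303), FILE 1 of 2).
The one road in print to the attackable conjunct `A_nc = PerNotNcVP` is HWY's Theorem 1.7
(`HWY10_thm_1_7_holds` in `NcSOSPermanent`), whose hypothesis `HWY10.SOSBilinearSuperlinear ℂ` is the
numeric conjecture `S_ℂ(SOS_k) ≥ Ω(k^{1+ε})`. Along the COEFFICIENT DIAL `R ↦ "S_R(SOS_k) ≥ c·k^{1+ε}"`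
exactly one position is a theorem in print: `R = ℤ`, HWY's Theorem 1.10 (`S_ℤ(k) ≥ Ω(k^{6/5})`; journal
version Canad. Math. Bull. 56 (2013) 70–79, Thm 1.1). This file kernels its combinatorial core
(HWY App. E, after Yiu and Yuzvinsky): `Intercalate k n` (signed intercalate matrices with colours
from `Fin n`, App. E.1 (1)–(3)), `Full s n` (diagonal of one colour, sign `+`), `Full.transport`
(Lemma E.7 in sign-exponent form), `Full.not_three` (Prop E.8: an ordered colour pair occurs in at most
two positions `i < j < l`), `Full.cube_le` (Lemma E.4 as `⌊s/3⌋³ ≤ 2n²`), `Intercalate.full` /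
`Intercalate.exists_fiber` (Thm E.5, steps `M(0) … M(3)` on a largest colour class) and the headline
`Intercalate.bound : k ^ 6 ≤ 250 * n ^ 5` (Thm E.5 in numeric form; crude constants). The sequel
`IntegerSumsOfSquares` derives the bound for `sqComplexity ℤ (HWY10.sosPoly ℤ k)`.

HONEST FRAMING: a theorem in print since 2010 (elementary combinatorics), kernel-new; it calibrates the
INTEGER position of the road's coefficient dial — no statement about `S_ℂ`, and no circuit lower bound
follows (HWY p. 6); nothing here bears on `VP ≠ VNP`.

## References
* [HrubesWigdersonYehudayoff2010] P. Hrubeš, A. Wigderson, A. Yehudayoff, Non-commutative circuits and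
  the sum-of-squares problem, STOC 2010, 667–676: Thm 1.10 and Appendix E (E.1, Facts E.2/E.3/E.6,
  Lemma E.4, Thm E.5, Lemma E.7, Prop E.8). Journal version of App. E [HrubesWigdersonYehudayoff2013]:
  An asymptotic bound on the composition number of integer sums of squares formulas, Canad. Math.
  Bull. 56 (2013) 70–79, doi:10.4153/CMB-2011-143-x (Thm 1.1, Prop 2.2, Lemma 3.3, Thm 3.4, Fact 3.5,
  Lemma 3.6, Prop 3.7).
* [Yiu1987] P. Yiu, Sums of squares formulae with integer coefficients, Canad. Math. Bull. 30 (1987)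
  318–324. [Yuzvinsky1981] S. Yuzvinsky, Orthogonal pairings of Euclidean spaces, Michigan Math. J. 28
  (1981) 131–145.
-/
noncomputable section

namespace Summit.ValiantsHypothesis.ValiantsHypothesis.Theorems.IntercalateMatrix

/-- A (consistently signed) `k × k` INTERCALATE MATRIX with colours from `Fin n`
(Yiu; HWY–CMB §2): cell `(i,j)` carries the colour `c i j` (= `|M_{ij}|`) and the sign exponent
`σ i j : ZMod 2` (`M_{ij} = (-1)^{σ i j} · colour`); colours are injective along rows and columns, and a
`2 × 2` minor with equal diagonal colours has equal anti-diagonal colours and sign product `-1`.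
[cite: HrubesWigdersonYehudayoff2010, App. E.1 (1)–(3); Yiu1987; Yuzvinsky1981] -/
structure Intercalate (k n : ℕ) where
  /-- the colour `|M_{ij}|` of cell `(i, j)` -/
  c : Fin k → Fin k → Fin n
  /-- the sign exponent of cell `(i, j)` -/
  σ : Fin k → Fin k → ZMod 2
  row_inj : ∀ i : Fin k, Function.Injective (c i)
  col_inj : ∀ j : Fin k, Function.Injective fun i => c i j
  inter : ∀ ⦃i₁ i₂ j₁ j₂ : Fin k⦄, i₁ ≠ i₂ → j₁ ≠ j₂ → c i₁ j₁ = c i₂ j₂ →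
    c i₁ j₂ = c i₂ j₁ ∧ σ i₁ j₁ + σ i₁ j₂ + σ i₂ j₁ + σ i₂ j₂ = 1

/-- A FULL intercalate matrix: all diagonal cells carry one colour `a` with sign `+`.
[cite: HrubesWigdersonYehudayoff2010, App. E.1 ("full")] -/
structure Full (s n : ℕ) extends Intercalate s n where
  /-- the diagonal colour -/
  a : Fin n
  diag_c : ∀ i : Fin s, c i i = a
  diag_σ : ∀ i : Fin s, σ i i = 0

/-- The POSITIONS of an `s × s` matrix: triples `i < j < l`.
[cite: HrubesWigdersonYehudayoff2010, App. E.1 (positions)] -/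
def positions (s : ℕ) : Finset (Fin s × Fin s × Fin s) :=
  Finset.univ.filter fun t => t.1 < t.2.1 ∧ t.2.1 < t.2.2

/-- Membership in `positions`. [cite: HrubesWigdersonYehudayoff2010, App. E.1 (positions)] -/
theorem mem_positions {s : ℕ} {t : Fin s × Fin s × Fin s} : t ∈ positions s ↔ t.1 < t.2.1 ∧ t.2.1 < t.2.2 := by
  simp only [positions, Finset.mem_filter, Finset.mem_univ, true_and]

namespace Full

variable {s n : ℕ} (M : Full s n)

/-- Off the diagonal the colours are symmetric (`|M_{ij}| = |M_{ji}|`). [cite: HrubesWigdersonYehudayoff2010, App. E Fact E.6] -/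
theorem symm_c {i j : Fin s} (h : i ≠ j) : M.c i j = M.c j i :=
  (M.inter h h ((M.diag_c i).trans (M.diag_c j).symm)).1

/-- … and the signs antisymmetric (`M_{ij} = -M_{ji}`). [cite: HrubesWigdersonYehudayoff2010, App. E Fact E.6] -/
theorem antisymm_σ {i j : Fin s} (h : i ≠ j) : M.σ i j + M.σ j i = 1 := by
  have h2 := (M.inter h h ((M.diag_c i).trans (M.diag_c j).symm)).2
  have di := M.diag_σ i
  have dj := M.diag_σ j
  linear_combination h2 - di - dj

/-- The sign invariant of a position: `u(i,j,l) = σ_{ij} + σ_{il} + σ_{jl}`. [cite: HrubesWigdersonYehudayoff2010, App. E Lemma E.7] -/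
def u (i j l : Fin s) : ZMod 2 := M.σ i j + M.σ i l + M.σ j l

/-- Transport (HWY–CMB Lemma 3.6, sign-exponent form). If two triples on six suitably distinct
indices carry the same colours at `(i,j),(i',j')` and at `(i,l),(i',l')`, then also at
`(j,l),(j',l')`, and the sign invariants differ by one (`b = -4` in HWY's picture).
[cite: HrubesWigdersonYehudayoff2010, App. E Lemma E.7] -/
theorem transport {i j l i' j' l' : Fin s} (hij : i ≠ j) (hil : i ≠ l) (hjl : j ≠ l)
    (hjj' : j ≠ j') (hji' : j ≠ i') (hij' : i ≠ j') (hli' : l ≠ i') (hil' : i ≠ l')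
    (hj'l : j' ≠ l) (hjl' : j ≠ l')
    (h₁ : M.c i j = M.c i' j') (h₂ : M.c i l = M.c i' l') :
    M.c j l = M.c j' l' ∧ M.u i' j' l' = M.u i j l + 1 := by
  -- cells (j, i) and (i', j')
  have s1 := M.inter hji' hij' (by rw [← M.symm_c hij, h₁])
  -- cells (l, i) and (i', l')
  have s2 := M.inter hli' hil' (by rw [← M.symm_c hil, h₂])
  -- cells (j', j) and (l, l')
  have s3 := M.inter hj'l hjl' (by rw [← M.symm_c hjj', s1.1, s2.1])
  refine ⟨?_, ?_⟩
  · rw [s3.1]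
    exact M.symm_c hjl
  · have a1 := M.antisymm_σ hij
    have a2 := M.antisymm_σ hil
    have a3 := M.antisymm_σ hjl
    have a4 := M.antisymm_σ hjj'
    have e1 := s1.2
    have e2 := s2.2
    have e3 := s3.2
    have t1 := CharTwo.add_self_eq_zero (M.σ i' l')
    have t2 := CharTwo.add_self_eq_zero (M.σ i l)
    have two : (2 : ZMod 2) = 0 := CharTwo.two_eq_zero
    unfold u
    linear_combination e1 - e2 + e3 - a1 + a2 - a3 - a4 + t1 - t2 - two

/-- The pair of colours read off a position. [cite: HrubesWigdersonYehudayoff2010, App. E.1 ("(a,b) occurs in position")] -/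
def pairMap (t : Fin s × Fin s × Fin s) : Fin n × Fin n := (M.c t.1 t.2.1, M.c t.1 t.2.2)

/-- The distinctness bookkeeping of HWY Prop E.8 (cases (2)–(4) of its proof): two different positions
with the same colour pair have pairwise distinct indices (one direction; apply twice).
[cite: HrubesWigdersonYehudayoff2010, App. E Prop E.8 (proof, (1)–(4))] -/
theorem cross_ne {i j l i' j' l' : Fin s} (oi : i < j) (oj : j < l) (oi' : i' < j') (oj' : j' < l')
    (hne : (i, j, l) ≠ (i', j', l')) (h₁ : M.c i j = M.c i' j') (h₂ : M.c i l = M.c i' l') :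
    i ≠ i' ∧ j ≠ j' ∧ l ≠ l' ∧ l ≠ j' ∧ i' ≠ j ∧ i' ≠ l := by
  have hii' : i ≠ i' := by
    intro h
    apply hne
    have ej : j = j' := M.row_inj i (by rw [h₁, h])
    have el : l = l' := M.row_inj i (by rw [h₂, h])
    rw [h, ej, el]
  have hjj' : j ≠ j' := by
    intro h
    apply hii'
    exact M.col_inj j (by simpa only [← h] using h₁)
  have hll' : l ≠ l' := by
    intro h
    apply hii'
    exact M.col_inj l (by simpa only [← h] using h₂)
  -- the minor (i, j), (i', j'):  c i j' = c i' j
  have key := (M.inter hii' hjj' h₁).1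
  refine ⟨hii', hjj', hll', ?_, ?_, ?_⟩
  · -- (3): l = j' would put the colour of (i, l) at (i', j) and at (i', l')
    intro h
    have e : M.c i' j = M.c i' l' := by rw [← key, ← h, h₂]
    have hlt : j < l' := lt_trans oj (by rw [h]; exact oj')
    exact absurd (M.row_inj i' e) (ne_of_lt hlt)
  · -- (4), e = 1: i' = j would put the diagonal colour twice in row i
    intro h
    have e : M.c i j' = M.c i i := by rw [key, ← h, M.diag_c, M.diag_c]
    have hlt : i < j' := lt_trans oi (by rw [← h]; exact oi')
    exact (ne_of_lt hlt) (M.row_inj i e).symm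
  · -- (4), e = 2: i' = l likewise, through the minor (i, l), (i', l')
    intro h
    have key₂ := (M.inter hii' hll' h₂).1
    have e : M.c i l' = M.c i i := by rw [key₂, ← h, M.diag_c, M.diag_c]
    have hlt : i < l' := lt_trans (lt_trans oi oj) (by rw [← h]; exact lt_trans oi' oj')
    exact (ne_of_lt hlt) (M.row_inj i e).symm

/-- Two different positions with the same colour pair: sign invariants differ by one (index form). [cite: HrubesWigdersonYehudayoff2010, Prop E.8] -/
theorem shift_of {i j l i' j' l' : Fin s} (oi : i < j) (oj : j < l) (oi' : i' < j') (oj' : j' < l')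
    (hne : (i, j, l) ≠ (i', j', l')) (h₁ : M.c i j = M.c i' j') (h₂ : M.c i l = M.c i' l') :
    M.u i' j' l' = M.u i j l + 1 := by
  obtain ⟨-, hjj', -, hlj', hi'j, hi'l⟩ := M.cross_ne oi oj oi' oj' hne h₁ h₂
  obtain ⟨-, -, -, hl'j, hij', hil'⟩ := M.cross_ne oi' oj' oi oj (Ne.symm hne) h₁.symm h₂.symm
  exact (M.transport (ne_of_lt oi) (ne_of_lt (lt_trans oi oj)) (ne_of_lt oj) hjj' hi'j.symm hij'
    hi'l.symm hil' hlj'.symm hl'j.symm h₁ h₂).2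

/-- Two different positions with the same colour pair have sign invariants differing by one. [cite: HrubesWigdersonYehudayoff2010, Prop E.8] -/
theorem shift {t t' : Fin s × Fin s × Fin s} (ht : t ∈ positions s) (ht' : t' ∈ positions s)
    (hne : t ≠ t') (h : M.pairMap t = M.pairMap t') :
    M.u t'.1 t'.2.1 t'.2.2 = M.u t.1 t.2.1 t.2.2 + 1 := by
  obtain ⟨i, j, l⟩ := t
  obtain ⟨i', j', l'⟩ := t'
  simp only [mem_positions] at ht ht'
  simp only [pairMap, Prod.mk.injEq] at h
  exact M.shift_of ht.1 ht.2 ht'.1 ht'.2 hne h.1 h.2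

/-- HWY–CMB Proposition 3.7: a pair of colours occurs in at most two positions — three occurrences
give `u₁ = u₀ + 1`, `u₂ = u₀ + 1`, `u₂ = u₁ + 1`, i.e. `1 = 0` in `ZMod 2` (`c₁ = -c₁` in HWY's words).
[cite: HrubesWigdersonYehudayoff2010, App. E Prop E.8] -/
theorem not_three {t₀ t₁ t₂ : Fin s × Fin s × Fin s} (h₀ : t₀ ∈ positions s) (h₁ : t₁ ∈ positions s)
    (h₂ : t₂ ∈ positions s) (h₀₁ : t₀ ≠ t₁) (h₀₂ : t₀ ≠ t₂) (h₁₂ : t₁ ≠ t₂)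
    (e₁ : M.pairMap t₀ = M.pairMap t₁) (e₂ : M.pairMap t₀ = M.pairMap t₂) : False := by
  have s₀₁ := M.shift h₀ h₁ h₀₁ e₁
  have s₀₂ := M.shift h₀ h₂ h₀₂ e₂
  have s₁₂ := M.shift h₁ h₂ h₁₂ (e₁.symm.trans e₂)
  have h10 : (1 : ZMod 2) = 0 := by linear_combination s₀₂ - s₀₁ - s₁₂
  exact absurd h10 (by decide)

/-- Each fibre of the pair map on positions has at most two elements. [cite: HrubesWigdersonYehudayoff2010, App. E Prop E.8] -/
theorem fiber_le_two (y : Fin n × Fin n) :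
    ((positions s).filter fun t => M.pairMap t = y).card ≤ 2 := by
  by_contra h
  rw [not_le, Finset.two_lt_card] at h
  obtain ⟨t₀, ht₀, t₁, ht₁, t₂, ht₂, h₀₁, h₀₂, h₁₂⟩ := h
  rw [Finset.mem_filter] at ht₀ ht₁ ht₂
  exact M.not_three ht₀.1 ht₁.1 ht₂.1 h₀₁ h₀₂ h₁₂ (ht₀.2.trans ht₁.2.symm) (ht₀.2.trans ht₂.2.symm)

include M in
/-- `#positions ≤ 2·n²` for a full `s × s` intercalate matrix with `≤ n` colours. [cite: HrubesWigdersonYehudayoff2010, Lemma E.4 (proof)] -/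
theorem card_positions_le : (positions s).card ≤ 2 * n ^ 2 := by
  have h := Finset.card_le_mul_card_image_of_maps_to (s := positions s)
    (t := (Finset.univ : Finset (Fin n × Fin n))) (f := M.pairMap) (fun _ _ => Finset.mem_univ _) 2
    (fun y _ => M.fiber_le_two y)
  simp only [Finset.card_univ, Fintype.card_prod, Fintype.card_fin] at h
  calc (positions s).card ≤ 2 * (n * n) := h
    _ = 2 * n ^ 2 := by ring

/-- `⌊s/3⌋³ ≤ #positions`, by the box injection `(a, b, c) ↦ (a, t + b, 2t + c)`, `t = ⌊s/3⌋`
(HWY: "at least `k³/8` positions"). [cite: HrubesWigdersonYehudayoff2010, App. E (proof of Lemma E.4)] -/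
theorem cube_le_card_positions (s : ℕ) : (s / 3) ^ 3 ≤ (positions s).card := by
  have hc : (Finset.univ : Finset (Fin (s / 3) × Fin (s / 3) × Fin (s / 3))).card = (s / 3) ^ 3 := by
    rw [Finset.card_univ, Fintype.card_prod, Fintype.card_prod, Fintype.card_fin]; ring
  rw [← hc]
  refine Finset.card_le_card_of_injOn
    (fun x => ((⟨(x.1 : ℕ), by have := x.1.isLt; omega⟩ : Fin s),
      (⟨s / 3 + (x.2.1 : ℕ), by have := x.2.1.isLt; omega⟩ : Fin s),
      (⟨2 * (s / 3) + (x.2.2 : ℕ), by have := x.2.2.isLt; omega⟩ : Fin s))) ?_ ?_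
  · intro x _
    rw [Finset.mem_coe, mem_positions]
    have hx₁ := x.1.isLt
    have hx₂ := x.2.1.isLt
    simp only [Fin.lt_def]
    omega
  · rintro ⟨a, b, c⟩ - ⟨a', b', c'⟩ - h
    simp only [Prod.mk.injEq, Fin.mk.injEq] at h
    obtain ⟨ha, hb, hc⟩ := h
    have ea : a = a' := Fin.ext (by omega)
    have eb : b = b' := Fin.ext (by omega)
    have ec : c = c' := Fin.ext (by omega)
    rw [ea, eb, ec]

include M in
/-- HWY–CMB Lemma 3.3 (numeric form): a full `s × s` intercalate matrix with `≤ n` colours has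
`(⌊s/3⌋)³ ≤ 2n²`. [cite: HrubesWigdersonYehudayoff2010, App. E Lemma E.4] -/
theorem cube_le : (s / 3) ^ 3 ≤ 2 * n ^ 2 :=
  (cube_le_card_positions s).trans M.card_positions_le

end Full

namespace Intercalate

variable {k n : ℕ} (M : Intercalate k n)

/-- The cells of colour `a`. [cite: HrubesWigdersonYehudayoff2010, App. E (proof of Thm E.5, `M_a`)] -/
def fiber (a : Fin n) : Finset (Fin k × Fin k) := Finset.univ.filter fun p => M.c p.1 p.2 = a

/-- Membership in a colour class. [cite: HrubesWigdersonYehudayoff2010, App. E (proof of Thm E.5)] -/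
theorem mem_fiber {a : Fin n} {p : Fin k × Fin k} : p ∈ M.fiber a ↔ M.c p.1 p.2 = a := by
  simp only [fiber, Finset.mem_filter, Finset.mem_univ, true_and]

/-- Pigeonhole: some colour class has `≥ k²/n` cells, as `k·k ≤ n·#M_a`. [cite: HrubesWigdersonYehudayoff2010, Thm E.5 (proof)] -/
theorem exists_fiber (hk : 0 < k) : ∃ a : Fin n, k * k ≤ n * (M.fiber a).card := by
  have hne : (Finset.univ : Finset (Fin n)).Nonempty := ⟨M.c ⟨0, hk⟩ ⟨0, hk⟩, Finset.mem_univ _⟩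
  obtain ⟨a, -, ha⟩ := Finset.exists_max_image Finset.univ (fun b => (M.fiber b).card) hne
  refine ⟨a, ?_⟩
  have h := Finset.card_le_mul_card_image_of_maps_to (s := (Finset.univ : Finset (Fin k × Fin k)))
    (t := (Finset.univ : Finset (Fin n))) (f := fun p : Fin k × Fin k => M.c p.1 p.2)
    (fun _ _ => Finset.mem_univ _)
    (M.fiber a).card (fun b _ => ha b (Finset.mem_univ b))
  simp only [Finset.card_univ, Fintype.card_prod, Fintype.card_fin] at h
  exact h.trans_eq (mul_comm _ _)

/-- A colour occurs at most once in each row … [cite: HrubesWigdersonYehudayoff2010, App. E.1 (1)] -/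
theorem eq_of_mem_fiber_of_fst_eq {a : Fin n} {p q : Fin k × Fin k} (hp : p ∈ M.fiber a)
    (hq : q ∈ M.fiber a) (h : p.1 = q.1) : p = q := by
  rw [mem_fiber] at hp hq
  have h2 : p.2 = q.2 := M.row_inj p.1 (by rw [hp, h, hq])
  exact Prod.ext h h2

/-- … and at most once in each column. [cite: HrubesWigdersonYehudayoff2010, App. E.1 (1)] -/
theorem eq_of_mem_fiber_of_snd_eq {a : Fin n} {p q : Fin k × Fin k} (hp : p ∈ M.fiber a)
    (hq : q ∈ M.fiber a) (h : p.2 = q.2) : p = q := by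
  rw [mem_fiber] at hp hq
  have h1 : p.1 = q.1 := M.col_inj p.2 (by
    change M.c p.1 p.2 = M.c q.1 p.2
    rw [hp, h, hq])
  exact Prod.ext h1 h

/-- The `t`-th cell of colour `a` (enumeration by `Finset.equivFin`) has colour `a`. [cite: HrubesWigdersonYehudayoff2010, Thm E.5 (proof, `M(2)`)] -/
theorem c_cell (a : Fin n) (t : Fin (M.fiber a).card) :
    M.c ((M.fiber a).equivFin.symm t).1.1 ((M.fiber a).equivFin.symm t).1.2 = a := by
  have h := ((M.fiber a).equivFin.symm t).2
  rw [mem_fiber] at h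
  exact h

/-- Distinct cells of one colour lie in distinct rows … [cite: HrubesWigdersonYehudayoff2010, App. E (proof of Thm E.5, `M(0)`)] -/
theorem cell_row_ne (a : Fin n) {t₁ t₂ : Fin (M.fiber a).card} (ht : t₁ ≠ t₂) :
    ((M.fiber a).equivFin.symm t₁).1.1 ≠ ((M.fiber a).equivFin.symm t₂).1.1 := fun h =>
  ht ((M.fiber a).equivFin.symm.injective (Subtype.ext
    (M.eq_of_mem_fiber_of_fst_eq ((M.fiber a).equivFin.symm t₁).2 ((M.fiber a).equivFin.symm t₂).2 h)))

/-- … and in distinct columns. [cite: HrubesWigdersonYehudayoff2010, App. E (proof of Thm E.5, `M(1)`)] -/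
theorem cell_col_ne (a : Fin n) {t₁ t₂ : Fin (M.fiber a).card} (ht : t₁ ≠ t₂) :
    ((M.fiber a).equivFin.symm t₁).1.2 ≠ ((M.fiber a).equivFin.symm t₂).1.2 := fun h =>
  ht ((M.fiber a).equivFin.symm.injective (Subtype.ext
    (M.eq_of_mem_fiber_of_snd_eq ((M.fiber a).equivFin.symm t₁).2 ((M.fiber a).equivFin.symm t₂).2 h)))

/-- The intercalate condition of the re-indexed, row-sign-normalised colour class (HWY Thm E.5,
`M(3)`: flipping whole rows preserves the sign rule). [cite: HrubesWigdersonYehudayoff2010, App. E Thm E.5 (proof)] -/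
theorem full_inter (a : Fin n) {t₁ t₂ u₁ u₂ : Fin (M.fiber a).card} (ht : t₁ ≠ t₂) (hu : u₁ ≠ u₂)
    (hc : M.c ((M.fiber a).equivFin.symm t₁).1.1 ((M.fiber a).equivFin.symm u₁).1.2 =
      M.c ((M.fiber a).equivFin.symm t₂).1.1 ((M.fiber a).equivFin.symm u₂).1.2) :
    M.c ((M.fiber a).equivFin.symm t₁).1.1 ((M.fiber a).equivFin.symm u₂).1.2 =
      M.c ((M.fiber a).equivFin.symm t₂).1.1 ((M.fiber a).equivFin.symm u₁).1.2 ∧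
    M.σ ((M.fiber a).equivFin.symm t₁).1.1 ((M.fiber a).equivFin.symm u₁).1.2 +
      M.σ ((M.fiber a).equivFin.symm t₁).1.1 ((M.fiber a).equivFin.symm t₁).1.2 +
    (M.σ ((M.fiber a).equivFin.symm t₁).1.1 ((M.fiber a).equivFin.symm u₂).1.2 +
      M.σ ((M.fiber a).equivFin.symm t₁).1.1 ((M.fiber a).equivFin.symm t₁).1.2) +
    (M.σ ((M.fiber a).equivFin.symm t₂).1.1 ((M.fiber a).equivFin.symm u₁).1.2 +
      M.σ ((M.fiber a).equivFin.symm t₂).1.1 ((M.fiber a).equivFin.symm t₂).1.2) +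
    (M.σ ((M.fiber a).equivFin.symm t₂).1.1 ((M.fiber a).equivFin.symm u₂).1.2 +
      M.σ ((M.fiber a).equivFin.symm t₂).1.1 ((M.fiber a).equivFin.symm t₂).1.2) = 1 := by
  have h := M.inter (M.cell_row_ne a ht) (M.cell_col_ne a hu) hc
  refine ⟨h.1, ?_⟩
  have e₁ := CharTwo.add_self_eq_zero
    (M.σ ((M.fiber a).equivFin.symm t₁).1.1 ((M.fiber a).equivFin.symm t₁).1.2)
  have e₂ := CharTwo.add_self_eq_zero
    (M.σ ((M.fiber a).equivFin.symm t₂).1.1 ((M.fiber a).equivFin.symm t₂).1.2)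
  linear_combination h.2 + e₁ + e₂

/-- The full intercalate matrix on a colour class (HWY–CMB Thm 3.4, steps `M(0) … M(3)`): rows and
columns of the cells of colour `a`, paired so that the `a`-cells become the diagonal, every row
sign-flipped by its `a`-cell; colours are not renamed. [cite: HrubesWigdersonYehudayoff2010, App. E Thm E.5 (proof)] -/
def full (a : Fin n) : Full (M.fiber a).card n where
  c t t' := M.c ((M.fiber a).equivFin.symm t).1.1 ((M.fiber a).equivFin.symm t').1.2
  σ t t' := M.σ ((M.fiber a).equivFin.symm t).1.1 ((M.fiber a).equivFin.symm t').1.2 +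
    M.σ ((M.fiber a).equivFin.symm t).1.1 ((M.fiber a).equivFin.symm t).1.2
  row_inj := by
    intro t u₁ u₂ h
    have h2 := M.row_inj ((M.fiber a).equivFin.symm t).1.1 h
    exact (M.fiber a).equivFin.symm.injective (Subtype.ext (M.eq_of_mem_fiber_of_snd_eq
      ((M.fiber a).equivFin.symm u₁).2 ((M.fiber a).equivFin.symm u₂).2 h2))
  col_inj := by
    intro u t₁ t₂ h
    have h1 : ((M.fiber a).equivFin.symm t₁).1.1 = ((M.fiber a).equivFin.symm t₂).1.1 :=
      M.col_inj ((M.fiber a).equivFin.symm u).1.2 h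
    exact (M.fiber a).equivFin.symm.injective (Subtype.ext (M.eq_of_mem_fiber_of_fst_eq
      ((M.fiber a).equivFin.symm t₁).2 ((M.fiber a).equivFin.symm t₂).2 h1))
  inter := by
    intro t₁ t₂ u₁ u₂ ht hu hc
    exact M.full_inter a ht hu hc
  a := a
  diag_c := by
    intro t
    exact M.c_cell a t
  diag_σ := by
    intro t
    exact CharTwo.add_self_eq_zero _

/-- HWY–CMB Theorem 3.4 (numeric form): a `k × k` intercalate matrix with `≤ n` colours has
`k⁶ ≤ 250·n⁵`, i.e. `n ≥ 250^{-1/5}·k^{6/5}` — via the full matrix on a largest colour class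
(`k·k ≤ n·s`) and `⌊s/3⌋³ ≤ 2n²`; crude constants. No circuit lower bound follows (HWY p. 6); does not
bear on `S_ℂ`. [cite: HrubesWigdersonYehudayoff2010, Thm 1.10 / App. E Thm E.5] -/
theorem bound (M : Intercalate k n) : k ^ 6 ≤ 250 * n ^ 5 := by
  rcases Nat.eq_zero_or_pos k with hk | hk
  · subst hk
    simp
  obtain ⟨a, ha⟩ := M.exists_fiber hk
  have hcube := (M.full a).cube_le
  obtain ⟨s, hs⟩ : ∃ s, (M.fiber a).card = s := ⟨_, rfl⟩
  rw [hs] at ha hcube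
  have hn : 0 < n := by
    rcases Nat.eq_zero_or_pos n with h | h
    · rw [h, zero_mul] at ha
      exact absurd ha (not_le.2 (Nat.mul_pos hk hk))
    · exact h
  have h1 : k ^ 6 ≤ (n * s) ^ 3 :=
    calc k ^ 6 = (k * k) ^ 3 := by ring
      _ ≤ (n * s) ^ 3 := Nat.pow_le_pow_left ha 3
  rcases Nat.eq_zero_or_pos (s / 3) with ht | ht
  · have hs2 : s ≤ 2 := by omega
    calc k ^ 6 ≤ (n * s) ^ 3 := h1
      _ ≤ (n * 2) ^ 3 := Nat.pow_le_pow_left (Nat.mul_le_mul_left n hs2) 3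
      _ = 8 * n ^ 3 := by ring
      _ ≤ 250 * n ^ 5 :=
        Nat.mul_le_mul (by norm_num) (Nat.pow_le_pow_right hn (by norm_num))
  · have hs5 : s ≤ 5 * (s / 3) := by omega
    calc k ^ 6 ≤ (n * s) ^ 3 := h1
      _ ≤ (n * (5 * (s / 3))) ^ 3 := Nat.pow_le_pow_left (Nat.mul_le_mul_left n hs5) 3
      _ = n ^ 3 * (125 * (s / 3) ^ 3) := by ring
      _ ≤ n ^ 3 * (125 * (2 * n ^ 2)) :=
        Nat.mul_le_mul_left _ (Nat.mul_le_mul_left _ hcube)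
      _ = 250 * n ^ 5 := by ring

end Intercalate

end Summit.ValiantsHypothesis.ValiantsHypothesis.Theorems.IntercalateMatrix

end
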